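import Summits.AtomisticToContinuum.FouriersLaw.Theses.BondHeatUncertainty
import Literature.Probability.Entropy.StrongDataProcessingProofs

/-!
# Disproof attempts on `LinearResponseFTUR` (crux ★ of route BondHeatUncertainty, stmt-AtomisticToContinuum-9122) — findings

Standing disprover; cycle 1 `refuter-cdisprove-stmt-AtomisticToContinuum-9122-0` (2026-08-16 00:50Z),
cycle 2 `refuter-cdisprove-stmt-AtomisticToContinuum-9122-g2-0` (2026-08-16, this revision).
VERDICT SO FAR: **no kill; the crux is (conditionally) a theorem and is formally shielded.**
Everything below is checked Lean (no `sorry`) except where a docstring says "numerical".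

## Cycle-2 findings (new; details in §§6–9 and the Lean sections of the same numbers)
* §6 FORMAL SHIELD AS A THEOREM: `nessUnique_of_not_linearResponseFTUR : ¬(★) → ∃ params > 0, weak-NESS
  uniqueness ∀ N, T_L, T_R` — any refutation proves item 0741 at some parameters (and the vacuity flip side).
* §7 BOOKKEEPING CERTIFICATE: the `δ → 0` step of (★) is now a Lean theorem on real sequences
  (`fturShape_pointwise_of_hvv_family`): from HVV at each `δ` + `⟨Q_t⟩_δ/δ → G t` + `Var_δ → V` + the entropy
  balance `⟨Σ_t⟩ ≤ J_δ(1/T_R − 1/T_L) t + Kδ²` one gets EXACTLY `2G²t² ≤ V(Gt/T² + K)` (with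
  `tendsto_entropyProduction_div_sq`: `σ_δ/δ² → G/T²`). Cycle 1's "only conceivable kill = a bookkeeping slip"
  is thereby closed: the constants `2`, `T²`, per-bond `G` are certified; no sign hypothesis on `G`, `K` is even
  needed for the limit step. What remains for provers is purely the four physical inputs.
* §7b KERNEL/GENERATOR NORMALISATION re-audited (the tightness of (★) at `t → ∞` makes it load-bearing): drift
  `dp_i = -∂_{q_i}H - γ·bathWeight(i)·p_i`, noise `√(2γT_b)` (`LangevinChainKernel.solMap`,
  `LangevinChainHormander.drift`) versus `generator`'s `γ(T_b ∂²_p − p ∂_p)`: diffusion `γT_b = ½(√(2γT_b))²` ✓,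
  `N = 1` double bath ✓ — the constructed `transitionKernel N T T` IS the equal-temperature dynamics of
  `generator N T T`; no mismatch between the objects defining `μ` (weak FP class) and those defining `V_N`.
* §8 KL DIRECTION IS IMMATERIAL: `klDiv_momentumFlip_comm : KL(Θ_*μ‖μ) = KL(μ‖Θ_*μ)` for every finite `μ`
  (cards stating the entropy balance with `KL(Θμ_δ‖μ_δ)` feed hypothesis (b) verbatim).
* §9 TARGETS PRE-SCREEN (no stubs assigned yet; the ten first-lemma Props of `SketchIdeator1/2.lean` were
  attacked by hand): NONE is cheaply false. Verified identities: card A (`linear-score-cauchy-schwarz`)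
  `⟨Q_t,S_t⟩ = 2gt`, `½‖S_t‖² = k + gt/T²` (semigroup calculus from `LU = −j/T²`, `P_s† = ΘP_sΘ`), `g = T²·𝓔 ≥ 0`,
  and `h_odd = −(W − W∘Θ)/2` for EVERY bond (via `j_b = −T²ρ_src + ½L A_b`, `A_b = H_{>b} − H_{≤b}` even), so
  `k = K_N`; `shape_of_gram_identities` certifies the Cauchy–Schwarz arithmetic. Ideator 2: Fisher sum rule
  `T_L I₀ + T_R I_{N−1} = 2` checked on Gibbs and on the `N = 1` OU state; `GibbsFlipDetailedBalance`,
  `HeatWeightedFlipDuality` reduce at `T_L = T_R` to Θ-detailed balance of Gibbs ✓; `ExponentialHeatSumRule`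
  = `e^{Q_b/T_b} = e^{γt}ℰ_b` with the Itô term `γT_b dt` inside `Δ(p_b²/2)` ✓ (anti-damped Girsanov).
* LITERATURE ANCHORS (page level): HVV PRL 123 (2019) 110602 = arXiv:1902.06376 p.4: "any set of observables
  σ and φ that satisfy the fluctuation theorem of Eq. (5) admit the FTUR" — our `Σ_t = log dP/dΘ̃_*P` qualifies by
  construction; Van Vu–Hasegawa PRE 100 (2019) 032130 = arXiv:1901.05715 p.4 eq. (ent.decomp): with the
  UNFLIPPED final density as the reversed initial law one gets `Δs_tot` without boundary term, so
  `⟨Σ_t⟩ = ⟨Δs_tot⟩ + ⟨ln ρ(x_t)/ρ(Θx_t)⟩ = σt + KL(μ‖Θ_*μ)` — the crux's `K` is exactly this convention gap, and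
  p.8 ibid. "the original bound can be violated … for general underdamped systems" is the printed face of
  `fturShape_false_without_K`.
* NUMERICS OFF THE GAUSSIAN POINT (new regime, the crux's actual one `lam, β > 0`; RESULTS in §3b: 16 parameter
  sets, minimum margin 1.098 in the soft-pinning corner, Kubo identity exact, harmonic validation digit-perfect,
  MD cross-check of G, K, ∫C within 1σ): kit jobs j009962 + j013885
  (`num/anharmonic_ftur_n2.py`): N = 2, polynomial-Galerkin linear response (G, K = 2‖h_odd‖², Kubo identity
  `⟨j,g⟩` vs `T²G`, memory moment `M₁`) at (lam,β) ∈ {(0,0) validation,(½,½),(1,1),(2,2),(1,0),(0,1),(3,3)},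
  degrees 4–10, plus an MD cross-check (equilibrium `C(s)`, `V(t)`, NESS slope, nested-MC `K`) at (0,0),(1,1);
  margins `K/sup_t φ`, static and memory corners — §3b.

## 0. The statement, read back
`∀ ω₂ lam β γ > 0, (U) → ∀ μ steady-state family → ∀ T > 0 → ∀ D (δ-limits of totalCurrent/δ) →
 ∀ N ≥ 2, (a) 0 ≤ D N ∧ (b) ∀ b (b+1<N) ∀ t>0 ∀ K≥0, (KL(μ_{N,δ}‖Θ_*μ_{N,δ}) ≤ Kδ² eventually) →
 2 G² t² ≤ V_N(b,t) (G t/T² + K)`, `G = D N/(N-1)`, `V_N(b,t) = 2∫₀ᵗ(t-s) C_N(b,s) ds`,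
`C_N(b,s) = ∫ j_b · (P_s j_b) dμ_T` with the CONSTRUCTED kernels `transitionKernel N T T s` and the
tilted (normalised, probability) `gibbsMeasure N T`. Elaborates (rc 0). No junk found: `gibbsMeasure` is
`volume.tilted (-H/T)` (probability for ω₂>0, lam β ≥ 0), `transitionKernel` is the honest law of the
pathwise flow (Markov, `P_0 = id`), `klDiv` is Mathlib's (`= ∞` unless `μ ≪ ν` and llr integrable, so a
non-`O(δ²)` or infinite KL makes (b) VACUOUS, never false), `N - 1 ≥ 1`, `T² > 0`, `b+1<N` is a real bond,
`totalCurrent` sums the `N-1` real bonds (the last `bondCurrent` is `0`), so `G` IS the per-bond slope.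

## 1. Formal shield (why no `¬ LinearResponseFTUR` can be landed now)
Hypothesis (U) is weak-NESS uniqueness FOR EVERY `N` (= item NessUnique, stmt-0741, open, difficulty L:
needs "weak FP solution ⇒ semigroup-invariant" for a hypoelliptic operator with cubic drift). A proof of
`¬ LinearResponseFTUR` must DISCHARGE (U) for some positive parameters at every `N`; nothing in the tree
does (only existence, `CuneoEckmannHairerReyBellet2018_pinnedChain_holds`, and the explicit Gibbs /
harmonic Gaussian steady states). Dropping (U) does not help a refuter either: without (U) the family `μ`
is still pinned to weak steady states, and the only explicitly known non-equilibrium ones are the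
harmonic Gaussians (`lam = β = 0`, excluded by `0 < lam`, `0 < β`) — on which (★) HOLDS (§3).

## 2. Physics audit (paper; the derivation re-done independently of the planner)
* HVV FTUR `⟨φ⟩² ≤ ½ Var(φ)(e^{⟨Σ⟩} - 1)` is a THEOREM for any pair (Σ = log dP/dΘ̃_*P, φ Θ̃-odd):
  with Q := ½(P + Θ̃_*P), ⟨φ⟩_P = ⟨φ tanh(Σ/2)⟩_Q, ⟨φ²⟩_P = ⟨φ²⟩_Q, ⟨Σ⟩_P = ⟨Σ tanh(Σ/2)⟩_Q; Cauchy–Schwarz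
  + `tanh² a ≤ tanh(a tanh a)` (concavity) + Jensen give ⟨φ⟩² ≤ ⟨φ²⟩ tanh(⟨Σ⟩/2), i.e. the claim.
* Θ̃ = (time reversal)∘(momentum flip) maps solutions of the deterministic constraints (dq = p dt, interior
  dp = -∂H dt) to solutions, noise amplitudes per bath site are unchanged, so P_δ ~ Θ̃_*P_δ (Girsanov in
  the two noisy momenta only) and Onsager–Machlup gives Σ_t = log ρ_δ(ω₀) - log ρ_δ(Θω_t) - Q_L/T_L - Q_R/T_R,
  hence ⟨Σ_t⟩ = σ_δ t + KL(μ_δ‖Θ_*μ_δ), σ_δ = J_δ(1/T_R - 1/T_L) = G δ²/T² + o(δ²) (Maes–Netočný–Verschuere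
  2003 local detailed balance). Q_t^(b) = ∫₀ᵗ j_b is Θ̃-odd (j_b odd in p). ✔ planner's bookkeeping.
* Constants: ⟨Q_t⟩ = t J_δ = t(Gδ + o(δ)); divide HVV by δ²/2 and let δ → 0: exactly (b). ✔
* Open-chain Kubo identity (KDN 2009) re-derived: ∫₀^∞ C_N(b,s) ds = T² G for EVERY bond (time-reversal
  + energy balance of the half-chains), so V_N(b,t) = 2T²G t - 2M₁(b) + o(1), M₁(b) := ∫₀^∞ s C_N(b,s) ds,
  and (b) at t → ∞ reads K ≥ M₁(b)/T⁴ (Lemma `fturShape_memory_le`): (★) ⇔ K_N ≥ sup_t φ_b(t),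
  φ_b(t) := 2G²t²/V - Gt/T², φ_b(0+) = 2G²/⟨j_b²⟩ (static Cauchy–Schwarz), φ_b(∞) = M₁(b)/T⁴.
* (a) is the second law (J_δ·δ ≥ 0); moreover (b) ⇒ (a) whenever some K is admissible and V_N(b,t) > 0 at
  one late time (Lemma `fturShape_nonneg`), so (a) only carries weight when K_N = ∞ (then (b) is vacuous).
CONCLUSION: at fixed N the crux is true modulo regularity the provers must supply (smooth positive NESS
density with log-integrability for KL < ∞ — else (b) vacuous —, Itô/Dynkin for polynomial observables,
Gibbs-invariance of the constructed kernels, δ-continuity of Var_δ(Q_t)). None of these can make (★) FALSE: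
each failure mode makes a hypothesis of (b) fail (vacuity) rather than the inequality.

## 3. Numerical attack (exact Gaussian linear algebra on the harmonic member lam = β = 0, where the
NESS, K_N, G_N, C_N(b,s), V_N(b,t) are explicit; local pure-Python run `num/ftur_harmonic_pure.py`,
outputs `num/out_*.txt` attached as evidence; the numpy twin `num/ftur_harmonic.py` is kit job j007822,
N ≤ 64, still queued at publication). Sharp diagnostic: (★) ⇔ margin := K_N / sup_{t>0} φ_b(t) ≥ 1.
RESULT: margin ≥ 1 at every (parameter set, N, bond) tested — (ω₂,γ) ∈ {(1,1),(1,0.2),(1,5),(4,1),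
(0.25,1),(1,0.05)}, T = 1 (T scales out), N = 2…24 (full t-scan t ∈ (0,150], step 0.1, for N ≤ 8;
sup always attained at t → 0⁺, i.e. the static Cauchy–Schwarz corner φ_b(0+) = 2G²/⟨j_b²⟩); margin grows
≈ linearly in N (ω₂=γ=1: K_N = 0.2222, 0.3388, 0.4694, 0.7809, 1.1114, 1.7778, 2.4444, 3.7778 for
N = 2,3,4,6,8,12,16,24 ≈ N/6 - 2/9, G_N → 1/8, φ(0+) → 0.1131, margin 1.33 → 33.4). MINIMUM margin over
everything: N = 2, where margin = 1 + ω₂/(2+ω₂) independently of γ (1.3333 @ω₂=1, 1.1111 @0.25,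
1.0476 @0.1, 1.0050 @0.01): (★) is SATURATED in the corner (N = 2, ω₂ → 0, t → 0⁺) — h_odd ∝ j_b there —
but never violated (it cannot be: that corner is Cauchy–Schwarz). Checks: open-chain Kubo identity
∫₀^∞ C_N(b,s) ds = T²G_N to ≤ 1e-8 at every bond; bond conductances equal to 1e-12; V(t) = ⟨j²⟩t² + O(t³)
and V(t) = 2T²Gt - 2M₁ + o(1) both reproduced; M₁(b) < 0 for all N ≥ 3 (memory bound vacuous there),
M₁ = 1/12 < K_2T⁴ = 2/9 at N = 2. CONCLUSION: no numerical tension anywhere; the bookkeeping constants of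
(★) (factor 2, T², per-bond G = D/(N-1)) are the right ones (a slip would show as margin < 1 near the
saturation corner).

## 4. Load-bearing structure, as theorems on the real-variable SHAPE of (b)
`FTURShape G V T K := ∀ t>0, 2G²t² ≤ V t (G t/T² + K)`; `shape_of_linearResponseFTUR` shows the crux's
(b) IS this shape for its own `V`. Proved below:
* `fturShape_false_without_K`  — K is load-bearing: K = 0, G > 0 and V(t) ≤ c t² near 0 is impossible
  (the plain finite-time TUR is FALSE for these underdamped chains; K = 2‖h_odd‖² repairs it).
* `fturShape_static_bound`     — t → 0: K ≥ 2G²/c whenever V ≤ c t² near 0 (static Cauchy–Schwarz).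
* `fturShape_memory_le`        — t → ∞: V ≤ 2T²Gt - 2M eventually forces M ≤ K T⁴ (TIGHT: constant 2
  saturates by the Kubo identity; the crux predicts K_N T⁴ ≥ max_b ∫ s C_N(b,s) ds).
* `not_fturShape_two_add`      — the natural strengthening "constant 2+ε" is false under saturation.
* `fturShape_nonneg`           — (b) ⇒ (a): G < 0 is incompatible with V > 0 at late times.
* `fturShape_eq_zero_of_nonpos`— junk-sensitivity: V(t₀) ≤ 0 at one t₀ > 0 (e.g. a non-integrable
  autocorrelation making the interval integral 0) forces G = 0; provers must show s ↦ C_N(b,s) is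
  interval-integrable and V > 0.

## 5. Targets
payload.targets / stuck_stubs: empty at cycle 1. Nothing to attack yet.

## HANDOFF (for re-arms): fold j009962 into §3 (anharmonic margins); when a line is picked, turn §9 into
`<stub>_false` attempts on its actual stubs (the identities above say which constants a stub must carry);
re-run §7's certificate against any RESTATED (★) (per-bond vs total current, `T_L T_R` vs `T²`, `N` vs `N−1`):
a restatement that changes a constant is refuted by `not_fturShape_two_add` / `fturShape_memory_le` at once.
Landed under `Theorems/LinearResponseFTUR/Negative/`: KZeroCorner (p72637), ShapeConstraints (p72906),
Bookkeeping (p74595, accepted 2026-08-16, commit af1c6c613b3a).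
-/

namespace Summit.AtomisticToContinuum.FouriersLaw.Cruxes.LinearResponseFTUR.Disproof

open MeasureTheory Filter Topology
open Literature.MathematicalPhysics.KineticTheory.HeatConduction
open Summit.AtomisticToContinuum.FouriersLaw.Theses.BondHeatUncertainty

noncomputable section

/-! ## The real-variable shape of conclusion (b) -/

/-- The SHAPE of conclusion (b) of `LinearResponseFTUR` at one bond: `G = D_N/(N-1)` the conductance,
`V` the equilibrium bond-heat variance as a function of time, `T` the temperature, `K` an admissible
snapshot-irreversibility constant. -/
def FTURShape (G : ℝ) (V : ℝ → ℝ) (T K : ℝ) : Prop :=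
  ∀ t : ℝ, 0 < t → 2 * G ^ 2 * t ^ 2 ≤ V t * (G * t / T ^ 2 + K)

/-- The equilibrium current autocorrelation `C_N(b,s) = ∫ j_b (P_s j_b) dμ_T` of the crux (verbatim). -/
def eqCurrentAutocorr (ω₂ lam β γ T : ℝ) (N b : ℕ) (s : ℝ) : ℝ :=
  if h : b < N then
    ∫ z, (pinnedChain ω₂ lam β γ).bondCurrent N ⟨b, h⟩ z *
        (∫ y, (pinnedChain ω₂ lam β γ).bondCurrent N ⟨b, h⟩ y
          ∂((pinnedChain ω₂ lam β γ).transitionKernel N T T s.toNNReal z))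
      ∂((pinnedChain ω₂ lam β γ).gibbsMeasure N T)
  else 0

/-- The equilibrium bond-heat variance `V_N(b,t) = 2∫₀ᵗ (t-s) C_N(b,s) ds` of the crux (verbatim). -/
def bondHeatVariance (ω₂ lam β γ T : ℝ) (N b : ℕ) (t : ℝ) : ℝ :=
  2 * ∫ s in (0 : ℝ)..t, (t - s) * eqCurrentAutocorr ω₂ lam β γ T N b s

/-- LINK: conclusion (b) of the crux is exactly `FTURShape (D N/(N-1)) (V_N b) T K` for its own `V`.
So every lemma below about `FTURShape` is a statement about the crux. -/
theorem shape_of_linearResponseFTUR (h : LinearResponseFTUR) {ω₂ lam β γ : ℝ} (hω : 0 < ω₂)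
    (hl : 0 < lam) (hβ : 0 < β) (hγ : 0 < γ)
    (huniq : ∀ (N : ℕ) (T_L T_R : ℝ), 0 < T_L → 0 < T_R → ∀ μ ν : Measure (PhaseSpace N),
      (pinnedChain ω₂ lam β γ).IsSteadyState N T_L T_R μ →
      (pinnedChain ω₂ lam β γ).IsSteadyState N T_L T_R ν → μ = ν)
    (μ : (N : ℕ) → ℝ → ℝ → Measure (PhaseSpace N))
    (hμ : ∀ (N : ℕ) (T_L T_R : ℝ), 0 < T_L → 0 < T_R →
      (pinnedChain ω₂ lam β γ).IsSteadyState N T_L T_R (μ N T_L T_R))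
    {T : ℝ} (hT : 0 < T) (D : ℕ → ℝ)
    (hD : ∀ N : ℕ, Tendsto (fun δ : ℝ =>
      (pinnedChain ω₂ lam β γ).totalCurrent (μ N (T + δ / 2) (T - δ / 2)) / δ)
      (nhdsWithin 0 {(0 : ℝ)}ᶜ) (nhds (D N)))
    {N : ℕ} (hN : 2 ≤ N) {b : ℕ} (hb : b + 1 < N) {K : ℝ} (hK : 0 ≤ K)
    (hKL : ∀ᶠ δ in nhdsWithin (0 : ℝ) {(0 : ℝ)}ᶜ,
      InformationTheory.klDiv (μ N (T + δ / 2) (T - δ / 2))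
        (Measure.map (fun x : PhaseSpace N => (x.1, -x.2)) (μ N (T + δ / 2) (T - δ / 2)))
        ≤ ENNReal.ofReal (K * δ ^ 2)) :
    0 ≤ D N ∧ FTURShape (D N / ((N : ℝ) - 1)) (bondHeatVariance ω₂ lam β γ T N b) T K := by
  have h' := h ω₂ lam β γ hω hl hβ hγ huniq μ hμ T hT D hD N hN
  refine ⟨h'.1, fun t ht => ?_⟩
  exact h'.2 b hb t ht K hK hKL

/-! ## (a) K is load-bearing; the static bound -/

/-- **K is load-bearing (the plain finite-time TUR is false here).** If the variance is at most
quadratic near `t = 0` (it is: `V(t) = ⟨j_b²⟩ t² + O(t³)`) and `G > 0`, the shape with `K = 0` fails.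
So any proof of (b) must use the snapshot-irreversibility term. -/
theorem fturShape_false_without_K {G T c t₀ : ℝ} {V : ℝ → ℝ} (hG : 0 < G) (hT : 0 < T)
    (ht₀ : 0 < t₀) (hV : ∀ t, 0 < t → t ≤ t₀ → V t ≤ c * t ^ 2) :
    ¬ FTURShape G V T 0 := by
  intro h
  -- choose t small: t ≤ t₀ and (|c|+1) t ≤ G T²
  set t := min t₀ (G * T ^ 2 / (|c| + 1)) with ht_def
  have hc1 : 0 < |c| + 1 := by positivity
  have htpos : 0 < t := lt_min ht₀ (by positivity)
  have ht1 : t ≤ t₀ := min_le_left _ _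
  have ht2 : t ≤ G * T ^ 2 / (|c| + 1) := min_le_right _ _
  have ht2' : t * (|c| + 1) ≤ G * T ^ 2 := by
    have := (le_div_iff₀ hc1).mp ht2; linarith
  have h1 := h t htpos
  have hVt := hV t htpos ht1
  have hT2 : 0 < T ^ 2 := by positivity
  -- 2 G² t² ≤ V t * (G t / T²) ≤ c t² (G t/T²) ≤ |c| t² G t / T²
  have hfac : 0 ≤ G * t / T ^ 2 + 0 := by positivity
  have h2 : V t * (G * t / T ^ 2 + 0) ≤ |c| * t ^ 2 * (G * t / T ^ 2 + 0) := by
    apply mul_le_mul_of_nonneg_right _ hfac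
    calc V t ≤ c * t ^ 2 := hVt
      _ ≤ |c| * t ^ 2 := by nlinarith [le_abs_self c, sq_nonneg t]
  have h3 : 2 * G ^ 2 * t ^ 2 ≤ |c| * t ^ 2 * (G * t / T ^ 2) := by simpa using h1.trans h2
  -- divide by G t² / T² > 0 : 2 G T² ≤ |c| t
  have h4 : 2 * G * T ^ 2 ≤ |c| * t := by
    have hpos : 0 < G * t ^ 2 := by positivity
    have : 2 * G ^ 2 * t ^ 2 * T ^ 2 ≤ |c| * t ^ 2 * (G * t) := by
      have := mul_le_mul_of_nonneg_right h3 hT2.le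
      calc 2 * G ^ 2 * t ^ 2 * T ^ 2 ≤ |c| * t ^ 2 * (G * t / T ^ 2) * T ^ 2 := this
        _ = |c| * t ^ 2 * (G * t) := by field_simp
    nlinarith
  nlinarith [abs_nonneg c]

/-- **Static bound (t → 0).** If `V(t) ≤ c t²` near `0` then the shape forces `2G² ≤ c K`
(= the Cauchy–Schwarz bound `K ≥ 2G²/⟨j_b²⟩`; consistent with `K_N = 2‖h_odd‖²`). -/
theorem fturShape_static_bound {G T K c t₀ : ℝ} {V : ℝ → ℝ} (h : FTURShape G V T K) (hG : 0 ≤ G)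
    (hT : 0 < T) (hK : 0 ≤ K) (hc : 0 < c) (ht₀ : 0 < t₀)
    (hV : ∀ t, 0 < t → t ≤ t₀ → V t ≤ c * t ^ 2) :
    2 * G ^ 2 ≤ c * K := by
  by_contra hlt
  push Not at hlt
  -- ε := 2G² - cK > 0; take t ≤ t₀ with c G t / T² < ε
  set ε := 2 * G ^ 2 - c * K with hε
  have hεpos : 0 < ε := by linarith
  set t := min t₀ (ε * T ^ 2 / (2 * (c * G + 1))) with ht_def
  have hcG : 0 < c * G + 1 := by positivity
  have htpos : 0 < t := lt_min ht₀ (by positivity)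
  have ht1 : t ≤ t₀ := min_le_left _ _
  have ht2 : t ≤ ε * T ^ 2 / (2 * (c * G + 1)) := min_le_right _ _
  have ht2' : t * (2 * (c * G + 1)) ≤ ε * T ^ 2 := (le_div_iff₀ (by positivity)).mp ht2
  have hT2 : 0 < T ^ 2 := by positivity
  have h1 := h t htpos
  have hfac : 0 ≤ G * t / T ^ 2 + K := by positivity
  have h2 : 2 * G ^ 2 * t ^ 2 ≤ c * t ^ 2 * (G * t / T ^ 2 + K) :=
    h1.trans (mul_le_mul_of_nonneg_right (hV t htpos ht1) hfac)
  -- divide by t²: 2G² ≤ c (G t/T² + K), i.e. ε ≤ c G t / T²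
  have h3 : 2 * G ^ 2 ≤ c * (G * t / T ^ 2 + K) := by
    have ht2pos : 0 < t ^ 2 := by positivity
    nlinarith
  have h4 : ε * T ^ 2 ≤ c * G * t := by
    have : ε ≤ c * G * t / T ^ 2 := by
      have := h3; rw [hε]; ring_nf; ring_nf at this; linarith
    have := (le_div_iff₀ hT2).mp this; linarith
  nlinarith

/-! ## (b) The t → ∞ end: tightness of the constant 2 and the memory bound -/

/-- **Memory bound (t → ∞; tightness).** If eventually `V(t) ≤ 2T²G t - 2M` (which the open-chain Kubo
identity `∫₀^∞ C = T²G` gives with `M = ∫₀^∞ s C(s) ds - o(1)`), then the shape forces `M ≤ K T⁴`.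
Reading for the route: the crux PREDICTS `K_N ≥ T⁻⁴ max_b ∫₀^∞ s C_N(b,s) ds`; the leading terms
`2G²t²` cancel exactly, so the constant `2` in (★) cannot be improved (next lemma). -/
theorem fturShape_memory_le {G T K M t₁ : ℝ} {V : ℝ → ℝ} (h : FTURShape G V T K) (hG : 0 < G)
    (hT : 0 < T) (hK : 0 ≤ K) (hV : ∀ t, t₁ ≤ t → V t ≤ 2 * T ^ 2 * G * t - 2 * M) :
    M ≤ K * T ^ 4 := by
  by_contra hlt
  push Not at hlt
  set ε := M - K * T ^ 4 with hε
  have hεpos : 0 < ε := by linarith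
  have hT2 : 0 < T ^ 2 := by positivity
  -- for t ≥ t₁, t > 0:  0 ≤ 2 G t (T² K - M/T²) - 2 M K, i.e. 2 G t ε ≤ -2 M K T²
  -- pick t := max (max t₁ 1) ((|M| * K * T ^ 2 + 1) / (G * ε))
  set t := max (max t₁ 1) ((|M| * K * T ^ 2 + 1) / (G * ε)) with ht_def
  have ht1 : t₁ ≤ t := (le_max_left _ _).trans (le_max_left _ _)
  have htpos : 0 < t := lt_of_lt_of_le one_pos ((le_max_right _ _).trans (le_max_left _ _))
  have ht3 : (|M| * K * T ^ 2 + 1) / (G * ε) ≤ t := le_max_right _ _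
  have ht3' : |M| * K * T ^ 2 + 1 ≤ t * (G * ε) := (div_le_iff₀ (by positivity)).mp ht3
  have h1 := h t htpos
  have hfac : 0 ≤ G * t / T ^ 2 + K := by positivity
  have h2 : 2 * G ^ 2 * t ^ 2 ≤ (2 * T ^ 2 * G * t - 2 * M) * (G * t / T ^ 2 + K) :=
    h1.trans (mul_le_mul_of_nonneg_right (hV t ht1) hfac)
  -- expand: (2T²Gt - 2M)(Gt/T² + K) = 2G²t² + 2T²GKt - 2MGt/T² - 2MK
  have h3 : 0 ≤ 2 * T ^ 2 * G * K * t - 2 * M * G * t / T ^ 2 - 2 * M * K := by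
    have : (2 * T ^ 2 * G * t - 2 * M) * (G * t / T ^ 2 + K)
        = 2 * G ^ 2 * t ^ 2 + (2 * T ^ 2 * G * K * t - 2 * M * G * t / T ^ 2 - 2 * M * K) := by
      field_simp; ring
    linarith [h2, this]
  -- multiply by T²: 0 ≤ 2 G t (K T⁴ - M) - 2 M K T² = -2 G t ε - 2 M K T²
  have h4 : 0 ≤ 2 * T ^ 4 * G * K * t - 2 * M * G * t - 2 * M * K * T ^ 2 := by
    have := mul_nonneg h3 hT2.le
    have e : (2 * T ^ 2 * G * K * t - 2 * M * G * t / T ^ 2 - 2 * M * K) * T ^ 2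
        = 2 * T ^ 4 * G * K * t - 2 * M * G * t - 2 * M * K * T ^ 2 := by
      field_simp
    linarith [this, e]
  have h5 : 2 * G * t * ε ≤ -(2 * M * K * T ^ 2) := by
    have : 2 * T ^ 4 * G * K * t - 2 * M * G * t = -(2 * G * t * ε) := by rw [hε]; ring
    linarith
  have h6 : -(2 * M * K * T ^ 2) ≤ 2 * (|M| * K * T ^ 2) := by
    have := neg_abs_le M
    nlinarith [mul_nonneg hK hT2.le]
  nlinarith [ht3', h5, h6]

/-- **The constant 2 is sharp (natural strengthening refuted).** Under the same late-time saturation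
`V(t) ≤ 2T²G t + A`, no inequality `(2+ε) G² t² ≤ V(t)(G t/T² + K)` can hold for all `t > 0`. -/
theorem not_fturShape_two_add {G T K A t₁ ε : ℝ} {V : ℝ → ℝ} (hG : 0 < G) (hT : 0 < T) (hK : 0 ≤ K)
    (hε : 0 < ε) (hV : ∀ t, t₁ ≤ t → V t ≤ 2 * T ^ 2 * G * t + A) :
    ¬ ∀ t : ℝ, 0 < t → (2 + ε) * G ^ 2 * t ^ 2 ≤ V t * (G * t / T ^ 2 + K) := by
  intro h
  have hT2 : 0 < T ^ 2 := by positivity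
  -- RHS ≤ 2G²t² + (2T²GK + AG/T²) t + AK ; LHS - RHS ≥ ε G² t² - c₁ t - c₀
  set c₁ := 2 * T ^ 2 * G * K + |A| * G / T ^ 2 with hc₁
  set c₀ := |A| * K with hc₀
  have hc₁nn : 0 ≤ c₁ := by positivity
  have hc₀nn : 0 ≤ c₀ := by positivity
  set t := max (max t₁ 1) ((c₁ + c₀ + 1) / (ε * G ^ 2)) with ht_def
  have ht1 : t₁ ≤ t := (le_max_left _ _).trans (le_max_left _ _)
  have htone : 1 ≤ t := (le_max_right _ _).trans (le_max_left _ _)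
  have htpos : 0 < t := lt_of_lt_of_le one_pos htone
  have ht3 : (c₁ + c₀ + 1) / (ε * G ^ 2) ≤ t := le_max_right _ _
  have ht3' : c₁ + c₀ + 1 ≤ t * (ε * G ^ 2) := (div_le_iff₀ (by positivity)).mp ht3
  have h1 := h t htpos
  have hfac : 0 ≤ G * t / T ^ 2 + K := by positivity
  have h2 : (2 + ε) * G ^ 2 * t ^ 2 ≤ (2 * T ^ 2 * G * t + A) * (G * t / T ^ 2 + K) :=
    h1.trans (mul_le_mul_of_nonneg_right (hV t ht1) hfac)
  have h3 : (2 * T ^ 2 * G * t + A) * (G * t / T ^ 2 + K)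
      = 2 * G ^ 2 * t ^ 2 + (2 * T ^ 2 * G * K + A * G / T ^ 2) * t + A * K := by
    field_simp; ring
  have h4 : ε * G ^ 2 * t ^ 2 ≤ (2 * T ^ 2 * G * K + A * G / T ^ 2) * t + A * K := by nlinarith [h2, h3]
  have h5 : (2 * T ^ 2 * G * K + A * G / T ^ 2) * t + A * K ≤ c₁ * t + c₀ := by
    have hA := le_abs_self A
    have : A * G / T ^ 2 ≤ |A| * G / T ^ 2 :=
      div_le_div_of_nonneg_right (mul_le_mul_of_nonneg_right hA hG.le) hT2.le
    nlinarith [mul_le_mul_of_nonneg_right hA hK]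
  -- ε G² t² ≤ c₁ t + c₀ ≤ (c₁ + c₀) t < ε G² t · t
  have h6 : c₁ * t + c₀ ≤ (c₁ + c₀) * t := by nlinarith
  nlinarith [h4, h5, h6, ht3', htpos]

/-! ## (c) (b) ⇒ (a); junk-sensitivity -/

/-- **(b) ⇒ (a).** If the bond-heat variance is positive at arbitrarily late times (it is ~ 2T²G t),
the shape alone forces `G ≥ 0`: for `G < 0` the factor `G t/T² + K` is eventually negative. So clause
(a) of the crux is only informative when NO `K` is admissible (K_N = ∞, (b) vacuous). -/
theorem fturShape_nonneg {G T K : ℝ} {V : ℝ → ℝ} (h : FTURShape G V T K) (hT : 0 < T)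
    (hV : ∀ t₀ : ℝ, ∃ t, t₀ ≤ t ∧ 0 < V t) : 0 ≤ G := by
  by_contra hG
  push Not at hG
  have hT2 : 0 < T ^ 2 := by positivity
  obtain ⟨t, ht, hVt⟩ := hV (max 1 ((K + 1) * T ^ 2 / (-G)))
  have htpos : 0 < t := lt_of_lt_of_le one_pos ((le_max_left _ _).trans ht)
  have ht2 : (K + 1) * T ^ 2 / (-G) ≤ t := (le_max_right _ _).trans ht
  have ht2' : (K + 1) * T ^ 2 ≤ t * (-G) := (div_le_iff₀ (by linarith)).mp ht2
  -- factor G t / T² + K ≤ -1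
  have hfac : G * t / T ^ 2 + K ≤ -1 := by
    have : G * t ≤ -((K + 1) * T ^ 2) := by linarith
    have : G * t / T ^ 2 ≤ -(K + 1) := by
      rw [div_le_iff₀ hT2]; linarith
    linarith
  have h1 := h t htpos
  have : V t * (G * t / T ^ 2 + K) ≤ V t * (-1) := mul_le_mul_of_nonneg_left hfac hVt.le
  nlinarith [sq_nonneg (G * t)]

/-- **Junk-sensitivity.** If `V(t₀) ≤ 0` at a single `t₀ > 0` (e.g. the Bochner/interval integral
returning `0` on a non-integrable autocorrelation) then, with `G ≥ 0` from (a), the shape forces `G = 0`.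
Provers must therefore establish interval-integrability of `s ↦ C_N(b,s)` and `V_N(b,t) > 0`. -/
theorem fturShape_eq_zero_of_nonpos {G T K t₀ : ℝ} {V : ℝ → ℝ} (h : FTURShape G V T K) (hG : 0 ≤ G)
    (hT : 0 < T) (hK : 0 ≤ K) (ht₀ : 0 < t₀) (hV : V t₀ ≤ 0) : G = 0 := by
  have h1 := h t₀ ht₀
  have hfac : 0 ≤ G * t₀ / T ^ 2 + K := by positivity
  have h2 : V t₀ * (G * t₀ / T ^ 2 + K) ≤ 0 := mul_nonpos_of_nonpos_of_nonneg hV hfac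
  have h3 : G ^ 2 * t₀ ^ 2 ≤ 0 := by linarith
  have h4 : G ^ 2 * t₀ ^ 2 = 0 := le_antisymm h3 (by positivity)
  have : G ^ 2 = 0 := by
    rcases mul_eq_zero.mp h4 with h | h
    · exact h
    · exact absurd h (by positivity)
  exact pow_eq_zero_iff (n := 2) (by norm_num) |>.mp this

/-! ## (d) Consistency of the crux at the `K = 0` corner (no uniqueness needed)

`fturShape_false_without_K` says the inequality with `K = 0` is impossible when `G > 0`. The crux is
nevertheless consistent there: its OWN hypothesis with `K = 0` forces `KL = 0`, i.e. `μ_δ = Θ_*μ_δ`,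
and a momentum-flip invariant state carries no current (`j_b ∘ Θ = -j_b`), so `D_N = 0` and (b) reads
`0 ≤ 0`. This is proved on the ACTUAL objects, for every steady-state family, without (U). -/

/-- Mean bond currents change sign under the push-forward by momentum reversal. -/
theorem integral_bondCurrent_map_flip (P : OscillatorChain) {N : ℕ} (μ : Measure (PhaseSpace N))
    (i : Fin N) :
    ∫ x, P.bondCurrent N i x ∂(Measure.map (fun x : PhaseSpace N => (x.1, -x.2)) μ) =
      -∫ x, P.bondCurrent N i x ∂μ := by
  have e : (fun x : PhaseSpace N => (x.1, -x.2)) = ⇑(momentumReversal N) := by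
    funext x; rfl
  rw [e, MeasureTheory.integral_map_equiv, ← integral_neg]
  refine integral_congr_ae (Eventually.of_forall fun x => ?_)
  show P.bondCurrent N i ((momentumReversal N) x) = -P.bondCurrent N i x
  rw [momentumReversal_apply]
  exact P.bondCurrent_neg_momentum N i x

/-- A momentum-flip invariant state carries no current. -/
theorem totalCurrent_eq_zero_of_flip_invariant (P : OscillatorChain) {N : ℕ}
    (μ : Measure (PhaseSpace N)) (h : μ = Measure.map (fun x : PhaseSpace N => (x.1, -x.2)) μ) :
    P.totalCurrent μ = 0 := by
  unfold OscillatorChain.totalCurrent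
  refine Finset.sum_eq_zero fun i _ => ?_
  have h1 := integral_bondCurrent_map_flip P μ i
  rw [← h] at h1
  linarith

/-- **The `K = 0` corner of the crux is consistent** (any chain, any steady-state family, no
uniqueness): if `KL(μ_{N,δ} ‖ Θ_*μ_{N,δ}) ≤ 0·δ²` eventually, then the response coefficient `D N`
vanishes, so conclusion (b) with `K = 0` holds trivially (`0 ≤ 0`). Hence the load-bearing `K`-term
(`fturShape_false_without_K`) can only be dropped where the crux does not need it. -/
theorem response_eq_zero_of_klDiv_zero (P : OscillatorChain)
    (μ : (N : ℕ) → ℝ → ℝ → Measure (PhaseSpace N))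
    (hμ : ∀ (N : ℕ) (T_L T_R : ℝ), 0 < T_L → 0 < T_R → P.IsSteadyState N T_L T_R (μ N T_L T_R))
    {T : ℝ} (hT : 0 < T) {N : ℕ} {D : ℝ}
    (hD : Tendsto (fun δ : ℝ => P.totalCurrent (μ N (T + δ / 2) (T - δ / 2)) / δ)
      (nhdsWithin 0 {(0 : ℝ)}ᶜ) (nhds D))
    (hKL : ∀ᶠ δ in nhdsWithin (0 : ℝ) {(0 : ℝ)}ᶜ,
      InformationTheory.klDiv (μ N (T + δ / 2) (T - δ / 2))
        (Measure.map (fun x : PhaseSpace N => (x.1, -x.2)) (μ N (T + δ / 2) (T - δ / 2)))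
        ≤ ENNReal.ofReal (0 * δ ^ 2)) :
    D = 0 := by
  have h2T : ∀ᶠ δ in nhdsWithin (0 : ℝ) {(0 : ℝ)}ᶜ, 0 < T + δ / 2 ∧ 0 < T - δ / 2 := by
    have h1 : ∀ᶠ δ in nhds (0 : ℝ), δ < 2 * T := eventually_lt_nhds (by linarith)
    have h2 : ∀ᶠ δ in nhds (0 : ℝ), -(2 * T) < δ := eventually_gt_nhds (by linarith)
    refine mem_nhdsWithin_of_mem_nhds ?_
    filter_upwards [h1, h2] with δ ha hb
    exact ⟨by linarith, by linarith⟩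
  have hev : ∀ᶠ δ in nhdsWithin (0 : ℝ) {(0 : ℝ)}ᶜ,
      P.totalCurrent (μ N (T + δ / 2) (T - δ / 2)) / δ = 0 := by
    filter_upwards [hKL, h2T] with δ hδ hab
    have hss := hμ N _ _ hab.1 hab.2
    haveI : IsProbabilityMeasure (μ N (T + δ / 2) (T - δ / 2)) := hss.1
    have h0 : InformationTheory.klDiv (μ N (T + δ / 2) (T - δ / 2))
        (Measure.map (fun x : PhaseSpace N => (x.1, -x.2)) (μ N (T + δ / 2) (T - δ / 2))) = 0 := by
      rw [zero_mul, ENNReal.ofReal_zero] at hδ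
      exact le_antisymm hδ bot_le
    have heq := (InformationTheory.klDiv_eq_zero_iff).mp h0
    rw [totalCurrent_eq_zero_of_flip_invariant P _ heq, zero_div]
  have hlim : Tendsto (fun δ : ℝ => P.totalCurrent (μ N (T + δ / 2) (T - δ / 2)) / δ)
      (nhdsWithin 0 {(0 : ℝ)}ᶜ) (nhds 0) :=
    (tendsto_congr' hev).mpr tendsto_const_nhds
  exact tendsto_nhds_unique hD hlim

/-! ## (e) Corollaries stated on the crux itself -/

/-- **Memory bound predicted by the crux.** Under `LinearResponseFTUR`, for the crux's own bond-heat
variance: late-time saturation `V_N(b,t) ≤ 2T²G t - 2M` (open-chain Kubo) and `D N > 0` force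
`M ≤ K T⁴` for every admissible `K` — the crux asserts `K_N ≥ T⁻⁴ ∫₀^∞ s C_N(b,s) ds` at every bond. -/
theorem linearResponseFTUR_memory_bound (h : LinearResponseFTUR) {ω₂ lam β γ : ℝ} (hω : 0 < ω₂)
    (hl : 0 < lam) (hβ : 0 < β) (hγ : 0 < γ)
    (huniq : ∀ (N : ℕ) (T_L T_R : ℝ), 0 < T_L → 0 < T_R → ∀ μ ν : Measure (PhaseSpace N),
      (pinnedChain ω₂ lam β γ).IsSteadyState N T_L T_R μ →
      (pinnedChain ω₂ lam β γ).IsSteadyState N T_L T_R ν → μ = ν)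
    (μ : (N : ℕ) → ℝ → ℝ → Measure (PhaseSpace N))
    (hμ : ∀ (N : ℕ) (T_L T_R : ℝ), 0 < T_L → 0 < T_R →
      (pinnedChain ω₂ lam β γ).IsSteadyState N T_L T_R (μ N T_L T_R))
    {T : ℝ} (hT : 0 < T) (D : ℕ → ℝ)
    (hD : ∀ N : ℕ, Tendsto (fun δ : ℝ =>
      (pinnedChain ω₂ lam β γ).totalCurrent (μ N (T + δ / 2) (T - δ / 2)) / δ)
      (nhdsWithin 0 {(0 : ℝ)}ᶜ) (nhds (D N)))
    {N : ℕ} (hN : 2 ≤ N) (hDpos : 0 < D N) {b : ℕ} (hb : b + 1 < N) {K : ℝ} (hK : 0 ≤ K)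
    (hKL : ∀ᶠ δ in nhdsWithin (0 : ℝ) {(0 : ℝ)}ᶜ,
      InformationTheory.klDiv (μ N (T + δ / 2) (T - δ / 2))
        (Measure.map (fun x : PhaseSpace N => (x.1, -x.2)) (μ N (T + δ / 2) (T - δ / 2)))
        ≤ ENNReal.ofReal (K * δ ^ 2))
    {M t₁ : ℝ} (hV : ∀ t, t₁ ≤ t → bondHeatVariance ω₂ lam β γ T N b t ≤
      2 * T ^ 2 * (D N / ((N : ℝ) - 1)) * t - 2 * M) :
    M ≤ K * T ^ 4 := by
  have hs := (shape_of_linearResponseFTUR h hω hl hβ hγ huniq μ hμ hT D hD hN hb hK hKL).2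
  have hG : 0 < D N / ((N : ℝ) - 1) := by
    have : (2 : ℝ) ≤ N := by exact_mod_cast hN
    exact div_pos hDpos (by linarith)
  exact fturShape_memory_le hs hG hT hK hV

/-! ## Numerics (harmonic member; see module docstring §3 for the verdict)

```
ω₂=1 γ=1 T=1      N:    2       3       4       5       6       8      10      12      16      20      24
K_N                  0.2222  0.3388  0.4694  0.6202  0.7809  1.1114  1.4445  1.7778  2.4444  3.1111  3.7778
G_N                  0.1667  0.1364  0.1279  0.1257  0.1252  0.1250  0.1250  0.1250  0.1250  0.1250  0.1250
max_b sup_t φ_b      0.1667  0.1190  0.1145  0.1122  0.1128  0.1130  0.1131  0.1131  0.1131  0.1131  0.1131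
margin K_N/sup φ     1.333   2.847   4.099   5.528   6.921   9.836   12.78   15.72   21.62   27.52   33.41
N = 2 corner: margin = 1+ω₂/(2+ω₂):  ω₂ = 1: 1.3333 · 0.25: 1.1111 · 0.1: 1.0476 · 0.05: 1.0244 · 0.01: 1.0050
other sets (min margin, at N=2): (1,0.2): 1.333 · (1,5): 1.333 · (4,1): 1.356 · (0.25,1): 1.111 · (1,0.05): 1.333
```
kit job j007822 (numpy version, N ≤ 64, 7 sets) queued behind ~3600 jobs at publication time; its summary
is attached to the item automatically when it ends. -/

/-! ## §3b Numerics OFF the Gaussian point (cycle 2): the anharmonic `N = 2` chain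

kit jobs j009962 (PART G) and j013885 (PART G with corner sets + PART M = MD cross-check; both outputs attached
to the item as evidence), script `num/anharmonic_ftur_n2.py`. Method: linear response in `L²(μ_T)` by polynomial Galerkin
(monomials of total degree ≤ d in `(q₀,q₁,p₀,p₁)`, centred, whitened; q-moments of the anharmonic Gibbs marginal
by 2D quadrature): `L†h = −ρ_src`, `ρ_src = γ(p₀² − p₁²)/(2T²)`; `G = ⟨j,h⟩`, `K = 2‖h_odd‖²`, `g = −L⁻¹j`,
Kubo column `⟨j,g⟩ = ∫₀^∞C` vs `T²G`, memory moment `M₁ = ∫₀^∞ sC = ‖g_odd‖² − ‖g_even‖²`, and `sup_t φ(t)`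
from the projected semigroup (`maxRe = −0.5`: stable; `V(40)` reproduces `2T²G·40 − 2M₁` to 4 digits).
VALIDATION (lam = β = 0): `G = 0.166667 = 1/6`, `K = 0.222222 = 2/9`, `⟨j²⟩ = 1/3`, `⟨j,g⟩ = T²G`,
`M₁ = 0.083333 = 1/12`, static margin `1.3333 = 4/3` — all exact values of cycle 1 hit at every degree.
RESULTS (ω₂ = γ = T = 1; converged in d: digits stable from d = 6; d = 10 shown; (★) ⇔ every margin ≥ 1):
```
 (lam,β)      G         K        ⟨j²⟩     ⟨j,g⟩=T²G?   M₁      | φ(0+)=2G²/⟨j²⟩  φ(∞)=M₁/T⁴  sup_t φ (t_at) | margin: static  memory   sup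
 (0  ,0  )  0.166667  0.222222  0.333333   exact      0.083333 |   0.166667        0.083333     0.1656 (0⁺)   |   1.3333   2.6667   1.3422
 (0.5,0.5)  0.222118  0.243710  0.556616   exact      0.069903 |   0.177272        0.069903     0.1757 (0⁺)   |   1.3748   3.4864   1.3874
 (1  ,1  )  0.247830  0.245075  0.704735   exact      0.056121 |   0.174305        0.056121     0.1724 (0⁺)   |   1.4060   4.3669   1.4213
 (2  ,2  )  0.277924  0.240422  0.928536   exact      0.034440 |   0.166373        0.034440     0.1642 (0⁺)   |   1.4451   6.9810   1.4645
 (3  ,3  )  0.296774  0.234143  1.106044   exact      0.017862 |   0.159261        0.017862     0.1569 (0⁺)   |   1.4702  13.1087   1.4928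
 (1  ,0  )  0.122367  0.179989  0.251676   exact      0.072932 |   0.118991        0.072932     0.1182 (0⁺)   |   1.5126   2.4679   1.5231
 (0  ,1  )  0.288603  0.236213  0.898269   exact      0.029579 |   0.185450        0.029579     0.1832 (0⁺)   |   1.2737   7.9859   1.2894
 corner sets (j013885), (lam,β;ω₂):
 (0 ,1 ;0.3)  0.326119  0.221216  1.098010   exact      0.001626 |   0.193720        0.001626     0.1911 (0⁺)   |   1.1419 136.0     1.1575
 (0 ,1 ;0.1)  0.337637  0.214715  1.165866   exact     -0.007966 |   0.195561       <0 (vacuous) 0.1928 (0⁺)   |   1.0979   vacuous  1.1134   ← minimum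
 (.01,1;0.1)  0.332666  0.217648  1.135818   exact     -0.003744 |   0.194867       <0           0.1922 (0⁺)   |   1.1169   vacuous  1.1324
 (0.1,1;0.1)  0.317286  0.225276  1.046812   exact      0.008570 |   0.192337        0.008570     0.1898 (0⁺)   |   1.1713  26.29     1.1868
 (1 ,1 ;0.1)  0.275256  0.241946  0.825088   exact      0.040102 |   0.183655        0.040102     0.1815 (0⁺)   |   1.3174   6.0333   1.3328
 (0 ,3 ;0.1)  0.380291  0.177174  1.869334   exact     -0.057637 |   0.154730       <0           0.1515 (0⁺)   |   1.1451   vacuous  1.1698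
 (0 ,5 ;1  )  0.375751  0.177611  2.037700   exact     -0.061652 |   0.138577       <0           0.1353 (0⁺)   |   1.2817   vacuous  1.3127
 (0 ,10;1  )  0.406245  0.144690  2.942737   exact     -0.102142 |   0.112164       <0           0.1085 (0⁺)   |   1.2900   vacuous  1.3335
 (0 ,1 ;3  )  0.204691  0.233737  0.544083   exact      0.069827 |   0.154015        0.069827     0.1525 (0⁺)   |   1.5176   3.3474   1.5327
 harmonic reference: margin = 1 + ω₂/(2+ω₂) = 1.0476 (ω₂=0.1), 1.1304 (0.3), 1.3333 (1), 1.6 (3).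
```
MD CROSS-CHECK (PART M of j013885; BAOAB dt = 0.01, 2000 replicas; errors 1σ): (lam,β) = (1,1): `⟨j²⟩ = 0.7041`
(Galerkin 0.7047), NESS slope `G = 0.2479 ± 0.0031` (Galerkin 0.24783), `∫₀³⁰C = 0.2462 ± 0.0032 = T²G` within 0.5σ
(open-chain Kubo identity BY SIMULATION, anharmonic), nested-MC `K = 2‖h_odd‖² = 0.2453 ± 0.0130` (Galerkin 0.24508),
`sup_t φ` at `t = 0.05`, margins 1.42 (sup) / 1.41 (static) / 12 (memory); (0,0): `⟨j²⟩ = 0.3336`, `∫C = 0.1667 ± 0.0016`,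
`G = 0.1695 ± 0.0025`, `K = 0.2308 ± 0.0133` (exact 1/3, 1/6, 1/6, 2/9) — the Galerkin linear response (hence every
number in the tables) is validated by direct simulation of the dynamics the crux speaks about.
READING: (★) holds at `N = 2` across the crux's actual regime `lam, β > 0` and all tested corners, minimum margin
1.098 at (lam,β;ω₂) = (0,1;0.1); the binding corner is ALWAYS the static Cauchy–Schwarz one (`t → 0⁺`), which cannot
be crossed; the margin tends to 1⁺ only in the soft-pinning limit `ω₂ → 0` (harmonic: `1 + ω₂/(2+ω₂)`), where
`h_odd` becomes parallel to `j_b` — i.e. the odd linear response degenerates into the 'local equilibrium with a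
current' ansatz `ρ_δ ∝ e^{−H/T}(1 + δ c j_b)`; quartic pinning (lam) widens the margin (1.33 → 1.51 at ω₂ = 1),
quartic coupling (β) narrows it at ω₂ = 1 (→ 1.27–1.29 for β = 1…10, saturating) but widens it at ω₂ = 0.1
(1.048 → 1.098). The memory corner is vacuous (`M₁ < 0`) for soft pinning / strong coupling and holds with margin
≥ 2.4 otherwise. The open-chain KUBO IDENTITY `∫₀^∞ C = T²G` holds to all
printed digits in every anharmonic set — it is an algebraic identity of the Galerkin scheme itself, i.e. a
consequence of the Θ-symmetry `L† = ΘLΘ` + energy balance alone (as g41-10 argued), not of Gaussianity; so the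
`t → ∞` saturation of (★) (`not_fturShape_two_add`) is exact in the anharmonic chain too, and the surviving
late-time content `M₁ ≤ K T⁴` holds with margin ≥ 2.4. No numerical tension anywhere. -/

/-! ## §6 Formal shield (cycle 2) -/

/-- **Formal shield.** Any refutation of the crux proves weak-NESS uniqueness (item 0741 `NessUnique`,
open) for SOME positive parameters, at every `N` and all bath temperatures. -/
theorem nessUnique_of_not_linearResponseFTUR (h : ¬ LinearResponseFTUR) :
    ∃ ω₂ lam β γ : ℝ, 0 < ω₂ ∧ 0 < lam ∧ 0 < β ∧ 0 < γ ∧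
      ∀ (N : ℕ) (T_L T_R : ℝ), 0 < T_L → 0 < T_R → ∀ μ ν : Measure (PhaseSpace N),
        (pinnedChain ω₂ lam β γ).IsSteadyState N T_L T_R μ →
        (pinnedChain ω₂ lam β γ).IsSteadyState N T_L T_R ν → μ = ν := by
  by_contra hne
  exact h fun ω₂ lam β γ hω hl hβ hγ huniq =>
    (hne ⟨ω₂, lam, β, γ, hω, hl, hβ, hγ, huniq⟩).elim

/-- **Vacuity flip side of the shield.** If weak-NESS uniqueness failed for every positive parameter
quadruple, the crux would hold vacuously. -/
theorem linearResponseFTUR_of_forall_not_unique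
    (hne : ∀ ω₂ lam β γ : ℝ, 0 < ω₂ → 0 < lam → 0 < β → 0 < γ →
      ¬ ∀ (N : ℕ) (T_L T_R : ℝ), 0 < T_L → 0 < T_R → ∀ μ ν : Measure (PhaseSpace N),
        (pinnedChain ω₂ lam β γ).IsSteadyState N T_L T_R μ →
        (pinnedChain ω₂ lam β γ).IsSteadyState N T_L T_R ν → μ = ν) :
    LinearResponseFTUR := by
  intro ω₂ lam β γ hω hl hβ hγ huniq
  exact absurd huniq (hne ω₂ lam β γ hω hl hβ hγ)

/-! ## §7 The `δ → 0` bookkeeping certificate (cycle 2) -/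

/-- Carnot factor algebra: `1/(T - δ/2) - 1/(T + δ/2) = δ / (T² - δ²/4)`. -/
theorem inv_sub_inv_temperatures {T δ : ℝ} (h₁ : T - δ / 2 ≠ 0) (h₂ : T + δ / 2 ≠ 0) :
    1 / (T - δ / 2) - 1 / (T + δ / 2) = δ / (T ^ 2 - δ ^ 2 / 4) := by
  have h3 : T ^ 2 - δ ^ 2 / 4 = (T - δ / 2) * (T + δ / 2) := by ring
  rw [h3, div_sub_div _ _ h₁ h₂]
  congr 1
  ring

/-- **Entropy-production asymptotics (`σ_δ = G δ²/T² + o(δ²)`).** If the mean bond current satisfies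
`J δ / δ → G` then the thermodynamic entropy production rate `σ_δ = J_δ (1/T_R - 1/T_L)` at
`T_L = T + δ/2`, `T_R = T - δ/2` satisfies `σ_δ / δ² → G / T²`. Certifies the `T²` of (★). -/
theorem tendsto_entropyProduction_div_sq {J : ℝ → ℝ} {G T : ℝ} (hT : 0 < T)
    (hJ : Tendsto (fun δ => J δ / δ) (𝓝[≠] 0) (𝓝 G)) :
    Tendsto (fun δ => J δ * (1 / (T - δ / 2) - 1 / (T + δ / 2)) / δ ^ 2) (𝓝[≠] 0)
      (𝓝 (G / T ^ 2)) := by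
  -- eventually |δ| < T, so the Carnot factor is δ/(T² - δ²/4)
  have hI : ∀ᶠ δ in 𝓝[≠] (0 : ℝ), δ ∈ Set.Ioo (-T) T ∧ δ ≠ 0 := by
    have h1 : ∀ᶠ δ in 𝓝 (0 : ℝ), δ ∈ Set.Ioo (-T) T := Ioo_mem_nhds (by linarith) hT
    have h1' : ∀ᶠ δ in 𝓝[≠] (0 : ℝ), δ ∈ Set.Ioo (-T) T := mem_nhdsWithin_of_mem_nhds h1
    have h2' : ∀ᶠ δ in 𝓝[≠] (0 : ℝ), δ ≠ 0 := self_mem_nhdsWithin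
    exact h1'.and h2'
  have hden : Tendsto (fun δ : ℝ => T ^ 2 - δ ^ 2 / 4) (𝓝[≠] 0) (𝓝 (T ^ 2)) := by
    have : Tendsto (fun δ : ℝ => T ^ 2 - δ ^ 2 / 4) (𝓝 0) (𝓝 (T ^ 2 - 0 ^ 2 / 4)) :=
      ((continuous_const.sub ((continuous_pow 2).div_const 4)).tendsto 0)
    simpa using this.mono_left nhdsWithin_le_nhds
  have hlim : Tendsto (fun δ => J δ / δ / (T ^ 2 - δ ^ 2 / 4)) (𝓝[≠] 0) (𝓝 (G / T ^ 2)) :=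
    hJ.div hden (by positivity)
  refine hlim.congr' ?_
  filter_upwards [hI] with δ hδ
  obtain ⟨⟨hlo, hhi⟩, hne⟩ := hδ
  have h₁ : T - δ / 2 ≠ 0 := by intro h; linarith
  have h₂ : T + δ / 2 ≠ 0 := by intro h; linarith
  have h₃ : T ^ 2 - δ ^ 2 / 4 ≠ 0 := by
    have : T ^ 2 - δ ^ 2 / 4 = (T - δ / 2) * (T + δ / 2) := by ring
    rw [this]; exact mul_ne_zero h₁ h₂
  rw [inv_sub_inv_temperatures h₁ h₂]
  field_simp

/-- `exp x - 1 ≤ x · exp x` for every real `x`. -/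
theorem exp_sub_one_le_mul_exp (x : ℝ) : Real.exp x - 1 ≤ x * Real.exp x := by
  have h := Real.add_one_le_exp (-x)
  have hx := Real.exp_pos x
  have : Real.exp (-x) * Real.exp x = 1 := by rw [← Real.exp_add]; simp
  nlinarith

/-- **Bookkeeping certificate (the `δ → 0` step of (★) is exactly right).** At one bond, one `t > 0`:
let `m δ = ⟨Q_t⟩_δ`, `v δ = Var_δ(Q_t)`, `s δ = ⟨Σ_t⟩_δ` along the two-temperature steady states
`T ± δ/2`. Assume, eventually as `δ → 0` (`δ ≠ 0`):
* the Hasegawa–Van Vu FTUR at each `δ`: `m² ≤ ½ v (e^s - 1)` (`Literature.Probability.Entropy.HasegawaVanVu2019_FTUR`);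
* `v ≥ 0`;
* the mean: `m δ / δ → G t` (stationarity `⟨Q_t⟩ = t J_δ` and `J_δ/δ → G = D_N/(N-1)`);
* δ-continuity of the variance: `v δ → V` (`= V_N(b,t)`);
* the entropy balance with the snapshot bound: `s δ ≤ (m δ/t)(1/(T-δ/2) - 1/(T+δ/2)) t + K δ²`
  (`⟨Σ_t⟩ = σ_δ t + KL(μ_δ‖Θ_*μ_δ)`, `σ_δ = J_δ (1/T_R - 1/T_L)`, `KL ≤ K δ²`).
Then `2 G² t² ≤ V (G t/T² + K)` — conclusion (b) of the crux with all its constants. So the only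
room for a refutation is in the four physical inputs, never in the limit bookkeeping. -/
theorem fturShape_pointwise_of_hvv_family {m v s : ℝ → ℝ} {G T K V t : ℝ} (ht : 0 < t)
    (hT : 0 < T)
    (hHVV : ∀ᶠ δ in 𝓝[≠] (0 : ℝ), m δ ^ 2 ≤ 1 / 2 * v δ * (Real.exp (s δ) - 1))
    (hv0 : ∀ᶠ δ in 𝓝[≠] (0 : ℝ), 0 ≤ v δ)
    (hm : Tendsto (fun δ => m δ / δ) (𝓝[≠] 0) (𝓝 (G * t)))
    (hv : Tendsto v (𝓝[≠] 0) (𝓝 V))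
    (hs : ∀ᶠ δ in 𝓝[≠] (0 : ℝ),
      s δ ≤ m δ / t * (1 / (T - δ / 2) - 1 / (T + δ / 2)) * t + K * δ ^ 2) :
    2 * G ^ 2 * t ^ 2 ≤ V * (G * t / T ^ 2 + K) := by
  -- the entropy bound is δ² · w δ with w δ → G t / T² + K
  set w : ℝ → ℝ := fun δ => m δ / δ / (T ^ 2 - δ ^ 2 / 4) + K with hw_def
  have hI : ∀ᶠ δ in 𝓝[≠] (0 : ℝ), δ ∈ Set.Ioo (-T) T ∧ δ ≠ 0 := by
    have h1 : ∀ᶠ δ in 𝓝 (0 : ℝ), δ ∈ Set.Ioo (-T) T := Ioo_mem_nhds (by linarith) hT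
    have h1' : ∀ᶠ δ in 𝓝[≠] (0 : ℝ), δ ∈ Set.Ioo (-T) T := mem_nhdsWithin_of_mem_nhds h1
    have h2' : ∀ᶠ δ in 𝓝[≠] (0 : ℝ), δ ≠ 0 := self_mem_nhdsWithin
    exact h1'.and h2'
  have hden : Tendsto (fun δ : ℝ => T ^ 2 - δ ^ 2 / 4) (𝓝[≠] 0) (𝓝 (T ^ 2)) := by
    have : Tendsto (fun δ : ℝ => T ^ 2 - δ ^ 2 / 4) (𝓝 0) (𝓝 (T ^ 2 - 0 ^ 2 / 4)) :=
      ((continuous_const.sub ((continuous_pow 2).div_const 4)).tendsto 0)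
    simpa using this.mono_left nhdsWithin_le_nhds
  have hw : Tendsto w (𝓝[≠] 0) (𝓝 (G * t / T ^ 2 + K)) :=
    (hm.div hden (by positivity)).add tendsto_const_nhds
  have hsq : Tendsto (fun δ : ℝ => δ ^ 2) (𝓝[≠] 0) (𝓝 0) := by
    have : Tendsto (fun δ : ℝ => δ ^ 2) (𝓝 0) (𝓝 (0 ^ 2)) := (continuous_pow 2).tendsto 0
    simpa using this.mono_left nhdsWithin_le_nhds
  have hx : Tendsto (fun δ : ℝ => δ ^ 2 * w δ) (𝓝[≠] 0) (𝓝 0) := by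
    simpa using hsq.mul hw
  have hexp : Tendsto (fun δ : ℝ => Real.exp (δ ^ 2 * w δ)) (𝓝[≠] 0) (𝓝 1) := by
    have := (Real.continuous_exp.tendsto 0).comp hx
    simpa [Function.comp_def] using this
  -- the entropy bound rewritten
  have hs' : ∀ᶠ δ in 𝓝[≠] (0 : ℝ), s δ ≤ δ ^ 2 * w δ := by
    filter_upwards [hs, hI] with δ hδ hδI
    obtain ⟨⟨hlo, hhi⟩, hne⟩ := hδI
    have h₁ : T - δ / 2 ≠ 0 := by intro h; linarith
    have h₂ : T + δ / 2 ≠ 0 := by intro h; linarith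
    have h₃ : T ^ 2 - δ ^ 2 / 4 ≠ 0 := by
      have : T ^ 2 - δ ^ 2 / 4 = (T - δ / 2) * (T + δ / 2) := by ring
      rw [this]; exact mul_ne_zero h₁ h₂
    have e : m δ / t * (1 / (T - δ / 2) - 1 / (T + δ / 2)) * t + K * δ ^ 2 = δ ^ 2 * w δ := by
      rw [inv_sub_inv_temperatures h₁ h₂, hw_def]
      field_simp
    linarith [hδ, e.le, e.ge]
  -- the chain of inequalities at each δ, divided by δ²
  have hev : ∀ᶠ δ in 𝓝[≠] (0 : ℝ),
      (m δ / δ) ^ 2 ≤ 1 / 2 * v δ * (w δ * Real.exp (δ ^ 2 * w δ)) := by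
    filter_upwards [hHVV, hv0, hs', hI] with δ h1 h2 h3 hδI
    obtain ⟨-, hne⟩ := hδI
    have hδ2 : 0 < δ ^ 2 := by positivity
    have h4 : Real.exp (s δ) - 1 ≤ Real.exp (δ ^ 2 * w δ) - 1 := by
      linarith [Real.exp_le_exp.mpr h3]
    have h5 : Real.exp (δ ^ 2 * w δ) - 1 ≤ δ ^ 2 * w δ * Real.exp (δ ^ 2 * w δ) :=
      exp_sub_one_le_mul_exp _
    have h6 : m δ ^ 2 ≤ 1 / 2 * v δ * (δ ^ 2 * w δ * Real.exp (δ ^ 2 * w δ)) := by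
      have := mul_le_mul_of_nonneg_left (h4.trans h5) (by positivity : (0 : ℝ) ≤ 1 / 2 * v δ)
      exact h1.trans this
    rw [div_pow, div_le_iff₀ hδ2]
    calc m δ ^ 2 ≤ 1 / 2 * v δ * (δ ^ 2 * w δ * Real.exp (δ ^ 2 * w δ)) := h6
      _ = 1 / 2 * v δ * (w δ * Real.exp (δ ^ 2 * w δ)) * δ ^ 2 := by ring
  have hL : Tendsto (fun δ => (m δ / δ) ^ 2) (𝓝[≠] 0) (𝓝 ((G * t) ^ 2)) := hm.pow 2
  have hR : Tendsto (fun δ => 1 / 2 * v δ * (w δ * Real.exp (δ ^ 2 * w δ))) (𝓝[≠] 0)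
      (𝓝 (1 / 2 * V * ((G * t / T ^ 2 + K) * 1))) :=
    (tendsto_const_nhds.mul hv).mul (hw.mul hexp)
  have key : (G * t) ^ 2 ≤ 1 / 2 * V * ((G * t / T ^ 2 + K) * 1) :=
    le_of_tendsto_of_tendsto hL hR hev
  nlinarith [key]

/-! ## §8 The direction of the snapshot KL is immaterial (cycle 2) -/

/-- **KL direction is immaterial for the momentum flip.** For every finite measure `μ` on phase space,
`KL(Θ_*μ ‖ μ) = KL(μ ‖ Θ_*μ)` (`Θ` an involutive measurable equivalence; KL is invariant under pushing both
arguments forward by `Θ`). So cards writing the entropy balance with `KL(Θμ_δ‖μ_δ)` feed the crux's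
hypothesis `KL(μ_δ‖Θμ_δ) ≤ Kδ²` verbatim. -/
theorem klDiv_momentumFlip_comm {N : ℕ} (μ : Measure (PhaseSpace N)) [IsFiniteMeasure μ] :
    InformationTheory.klDiv (μ.map fun x : PhaseSpace N => (x.1, -x.2)) μ =
      InformationTheory.klDiv μ (μ.map fun x : PhaseSpace N => (x.1, -x.2)) := by
  have e : (fun x : PhaseSpace N => (x.1, -x.2)) = ⇑(momentumReversal N) := by
    funext x; rfl
  rw [e]
  have hΘΘ : (⇑(momentumReversal N)) ∘ (⇑(momentumReversal N)) = id := by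
    funext x
    simp [momentumReversal_apply]
  have hback : (μ.map (momentumReversal N)).map (momentumReversal N) = μ := by
    rw [Measure.map_map (momentumReversal N).measurable (momentumReversal N).measurable, hΘΘ,
      Measure.map_id]
  have h := Literature.Probability.Entropy.klDiv_map_of_measurableEmbedding
    (momentumReversal N).measurableEmbedding μ (μ.map (momentumReversal N))
  rw [hback] at h
  exact h

/-- **Bookkeeping certificate, `FTURShape` form.** If the four physical inputs hold at every `t > 0`
(with `m t`, `v t`, `s t` the `δ`-families of mean, variance and mean entropy production of the bond heat
`Q_t`), conclusion (b) of the crux holds in its exact shape. -/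
theorem fturShape_of_hvv_family {m v s : ℝ → ℝ → ℝ} {G T K : ℝ} {V : ℝ → ℝ} (hT : 0 < T)
    (hHVV : ∀ t, 0 < t → ∀ᶠ δ in 𝓝[≠] (0 : ℝ), m t δ ^ 2 ≤ 1 / 2 * v t δ * (Real.exp (s t δ) - 1))
    (hv0 : ∀ t, 0 < t → ∀ᶠ δ in 𝓝[≠] (0 : ℝ), 0 ≤ v t δ)
    (hm : ∀ t, 0 < t → Tendsto (fun δ => m t δ / δ) (𝓝[≠] 0) (𝓝 (G * t)))
    (hv : ∀ t, 0 < t → Tendsto (v t) (𝓝[≠] 0) (𝓝 (V t)))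
    (hs : ∀ t, 0 < t → ∀ᶠ δ in 𝓝[≠] (0 : ℝ),
      s t δ ≤ m t δ / t * (1 / (T - δ / 2) - 1 / (T + δ / 2)) * t + K * δ ^ 2) :
    FTURShape G V T K := fun t ht =>
  fturShape_pointwise_of_hvv_family ht hT (hHVV t ht) (hv0 t ht) (hm t ht) (hv t ht) (hs t ht)

/-! ## §9 Targets pre-screen (cycle 2): the ideators' first lemmas

No line is picked and `stuck_stubs = []`, so there is nothing to kill yet. The ten `def … : Prop` of
`Cruxes/LinearResponseFTUR/SketchIdeator1.lean` (cards `linear-score-cauchy-schwarz`,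
`counting-field-detailed-balance`) and `SketchIdeator2.lean` (cards `boundary-fisher-sum-rule`,
`equilibrium-score-gram`, `lebesgue-flip-duality`) were attacked by hand (degenerate cases, constants, junk):

* `LinearScoreCauchySchwarz` — TRUE modulo Dynkin/regularity. With `U := W∘Θ`, `LU = −j/T²` (j odd), and on the
  stationary Gibbs process `S_t := Q_t/T² + U(x_t) − W(x_0)`:
  `⟨Q_t, U(x_t)⟩ − ⟨Q_t, W(x_0)⟩ = 2∫₀ᵗ⟨j, P_uU⟩du`, `⟨j,P_uU⟩ = g − T⁻²∫₀ᵘC`, hence `⟨Q_t,S_t⟩ = V/T² + 2gt − V/T² = 2gt`;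
  `‖U(x_t) − W(x_0)‖² = ‖W − W∘Θ‖² − 2gt/T² + V/T⁴`, hence `½‖S_t‖² = gt/T² + ½‖W − W∘Θ‖² = gt/T² + k`;
  `g = ⟨j,U⟩ = −T²⟨LU,U⟩ = T²·γT Σ_b‖∂_{p_b}U‖² ≥ 0`. Cauchy–Schwarz then gives EXACTLY the shape
  (`shape_of_gram_identities` below). Invariance under `W ↦ W + c` ✓ (g: `⟨j⟩ = 0`; k: constants cancel).
* `FlippedPoissonCorrector` — existence with `e^{θH}` 2-jet bounds, `θ < 1/(2T)` free: plausible (weighted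
  exponential ergodicity at equal temperatures + hypoelliptic smoothing); not cheaply attackable.
* `GreenKuboCorrectorForm` — `D_N/(N−1) = −⟨j_b, W_b⟩` for EVERY bond: consistent with the flat Green–Kubo matrix
  (cycle 1, g41-10) because `j_b − j_{b+1} = L H_{b+1}`-type identities make `−⟨j_b,W_b⟩` bond-independent.
* `SnapshotKLLowerBound` — `k ≤ K`: TRUE and ROBUST (it is the Donsker–Varadhan LOWER bound direction); moreover
  `k = K_N` exactly: `h_odd = −(W − W∘Θ)/2` for every bond, from `j_b/T² = −ρ_src + L A_b/(2T²)` and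
  `j_b/T² = ρ_src − L†A_b/(2T²)` (`A_b := H_{>b} − H_{≤b}` even, `ρ_src = γ(p_0² − p_{N−1}²)/(2T²)`), so
  `[(L†)⁻¹ + L⁻¹] j_b/T² = [(L†)⁻¹ − L⁻¹] ρ_src = −2h_odd` (the `A_b` terms cancel).
* `CountingFieldDetailedBalance` — at `T_L = T_R = T` it is Θ-detailed balance of the constructed kernel w.r.t.
  Gibbs (`e^{−H(x)/T}dx P_t(x,dy) = e^{−H(y)/T}dy P_t(Θy,dΘx)`) ✓; the general weight is `e^{−s_med}` with
  `s_med = −ΔV₂ − Q_t(1/T_L − 1/T_R)` from `q_L^{in} = ΔH_{≤b} + Q_t`, `q_R^{in} = ΔH_{>b} − Q_t` ✓ signs consistent.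
* `KineticFisherSumRule` — `∫L(log ρ)dμ = 0` gives `Σ_b γ(−T_b I_b + 1) = 0`, i.e. `T_L I₀ + T_R I_{N−1} = 2` ✓;
  Gibbs: `T·(1/T)·2 = 2` ✓; `N = 1` (OU at `(T_L+T_R)/2`, both integrals equal `2/(T_L+T_R)`) ✓. The cut-off
  argument needs `∫ρ^{1/2}·poly < ∞`, which follows from the exponential moment by Cauchy–Schwarz ✓.
* `FiniteDeltaClausius` — `(T_L − T_R)·totalCurrent ≥ 0` along unique steady states: the finite-δ second law;
  `N = 0, 1`: `totalCurrent = 0` ✓. Not cheaply attackable; true in physics.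
* `GibbsFlipDetailedBalance`, `HeatWeightedFlipDuality` — both reduce (f = g = 1: `∞ = ∞` in `ℝ≥0∞` ✓; equal
  temperatures: `e^{(Q_L+Q_R)/T} = e^{ΔH/T}`) to Θ-detailed balance of Gibbs ✓.
* `ExponentialHeatSumRule` — `Q_b := Δ(p_b²/2) + ∫p_b∂_{q_b}H = ∫(γT_b − γp_b²)dt + ∫√(2γT_b)p_b dW_b` (Itô), so
  `e^{Q_b/T_b} = e^{γt}ℰ(∫√(2γ/T_b)p_b dW_b)` and `E_z e^{Q_L/T_L+Q_R/T_R} = e^{2γt}` iff the product exponential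
  is a true martingale (tilted dynamics = anti-damped chain, non-explosive) ✓; `N ≥ 2` keeps the two sites apart ✓.
VERDICT: no target is false as stated; the constants every future stub must carry are the ones above. -/

/-- **Card-A arithmetic certificate.** The Gram identities `⟨Q_t,S_t⟩ = 2gt`, `½‖S_t‖² = k + gt/T²` and
Cauchy–Schwarz `⟨Q,S⟩² ≤ ‖Q‖²‖S‖²` (`‖Q_t‖² = V`) give exactly the shape of (b). -/
theorem shape_of_gram_identities {g t T k V QS SS : ℝ} (hQS : QS = 2 * g * t)
    (hSS : SS = 2 * (k + g * t / T ^ 2)) (hCS : QS ^ 2 ≤ V * SS) :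
    2 * g ^ 2 * t ^ 2 ≤ V * (g * t / T ^ 2 + k) := by
  rw [hQS, hSS] at hCS
  nlinarith [hCS]

end

end Summit.AtomisticToContinuum.FouriersLaw.Cruxes.LinearResponseFTUR.Disproof
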